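import Summits.BirchSwinnertonDyer.BirchSwinnertonDyer.Theorems.QuadraticBranchSignedControlPlusEtaNonsurjConjADoorMinus
import Literature.NumberTheory.EllipticCurves.FineSelmerClassGroupCriterionTorsionPointFieldEigen
import Literature.NumberTheory.EllipticCurves.FineSelmerClassGroupCriterionCyclotomicTower
import Literature.NumberTheory.NumberFields.EquivariantIwasawaLemmaAbsolute
import HarnessLib

/-!
# Route `QuadraticBranchSignedControl` (rung K8, cell `bsd-potss`), residual crux `PlusEtaMainConjectureNonsurj`
# (stmt-BirchSwinnertonDyer-19606): DOOR L6 WITH THE HECKE-REFINED EIGEN-TEST, FACT-FREE — statement (A) when the tautological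
# class of `Cl(ℚ(P))` comes from a TWIST (seat `bsd-potss-k8eta-c2` g21, sequel of p702974)

WHY. The k8eta-c2 g21 census at `p = 5` (kit j326603 / j326820 / j326929 / j326822) classifies the 188 K8 partner rows `W`: on 46 rows
`Cl(ℚ(P)) ⊗ 𝔽₅` has a tautological (`σ₂ = 2`) class, and the dimension of that eigenspace equals `s_W + s_V` on 187/188 rows, `s_E` = the
`𝔽₅`-dimension of the Mordell–Weil part of `Sel₀(ℚ, E[5])` (local tests at `5` and at the multiplicative primes with `5 ∣ v(Δ)`), `V = W^{(5)}`
the good supersingular ROW curve (`ℚ(V[5]) = ℚ(W[5])`, same stabiliser field `ℚ(P)`); the 188th row (378225bg1, `j = 0`) carries a cubic-twist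
class. The plain eigen-test (door L6, conjA-anchor g17 `CoatesSujatha2005.conjA_of_eigenHom_subfield`) cannot separate a class coming from
`Sel₀(ℚ, W[5])` (which kills (c2) for `W`: Hecke type RHO, 27/27 rows) from one coming from `Sel₀(ℚ, V[5])` or a cubic twist (Hecke types
TWIST / `T = 0`, 18/18 rows, where (c2) for `W` HOLDS). conjA-anchor g13's HECKE refinement
(`DeoRaySujatha2023.equivariantHom_classGroup_eq_zero_of_heckeEigenHom_subfield`) does: a tautological eigenfunctional descended from an
equivariant `Cl(ℚ(W[p])) → W[p]` also satisfies the Hecke relations `μ(N_{L/K}(τ · i[I])) = (#Gal(L/K)·a) • μ[I]` for `τ • P = a • P + Q`.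
Its only consumer so far was `thm39_of_homTrivial_of_heckeEigenHom_stabilizerField`, CONDITIONAL on the Deo–Ray–Sujatha Thm. 3.9 binder.

WHAT (fact-free). §1 `conjA_of_heckeEigenHom_subfield` — the twin of conjA-anchor g17's `conjA_of_eigenHom_subfield` with the eigen
hypothesis weakened to the Hecke-refined one (plus `hVH`: the `Γ_{ℚ(P)}`-fixed vectors of `W[p]` are the multiples of `P`): `W/ℚ`, `p` odd,
`W[p]` irreducible, (c1), `K ⊆ ℚ(W[p])` fixing `P ≠ 0`, `hVH`, «every additive `μ : Cl(𝓞_K) → ℤ/p` satisfying the tautological relations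
AND the Hecke relations vanishes», (c3) at `p` ⟹ statement (A) (`∃ γ D, D.X` f.g. over `ℤ_p`) — by g13's theorem at `S = ∅` and g17's
`conjA_of_homTrivial_divisionField`; NO named fact. §2 `conjA_partner_of_heckeEigenHom` — on the partner `W` of a row `V` of crux 19606
(`C • W^{(p*)} = V`): (c1), (c3), irreducibility discharged by p690512; displayed: `hVH` and the Hecke-refined eigen datum (kit certificate
«hecke13 verdict TWIST-TYPE / T = 0», 18 rows at `p = 5`).

HONEST FRAMING (cell `bsd-potss`; FULL-BSD rank ≤ 1 programme, HUMAN RULING D-0036/D-0074): TOOL THEOREMS ONLY — no definition, no named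
fact, no `sorry`, axioms standard; the eigen/Hecke data stay displayed (GRH class-group computations are evidence, never facts). No stub of
19606 is proved by name; the crux stays OPEN; nothing is booked; (A) and `BSD(W,p)` are claimed for no pair. `--supports stmt-BirchSwinnertonDyer-19606 --as helper`.

References: [CoatesSujatha2005] §3 Conjecture A, Thm. 3.4, Lemma 3.8; [DeoRaySujatha2023] Thm. 3.8 (c1)–(c3), Thm. 3.9 (b) (arXiv:2202.09937 pp. 9–10);
[NeukirchANT1999] Ch. III §1 Prop. (1.6) (iv); [Washington1997] §13.3 Lemmas 13.14–13.15; [Serre1972] §1.11 Prop. 12; [SilvermanAEC2009] X.5 Cor. 5.4.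
-/

set_option autoImplicit false
set_option linter.dupNamespace false
noncomputable section

open scoped Classical nonZeroDivisors

open NumberField IsDedekindDomain Field WeierstrassCurve
open Literature.NumberTheory.EllipticCurves Literature.NumberTheory.GaloisRepresentations
  Literature.NumberTheory.EllipticCurves.Rank1Residual Literature.NumberTheory.NumberFields Rat.HeightOneSpectrum
open Literature.NumberTheory.EllipticCurves.GreenbergSelmer (decomp)
open Literature.NumberTheory.EllipticCurves.CoatesSujatha2005 Literature.NumberTheory.EllipticCurves.DeoRaySujatha2023
open Summit.BirchSwinnertonDyer.Rank1Residual Summit.BirchSwinnertonDyer.Rank1Residual.GaloisImage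

namespace Summit.BirchSwinnertonDyer.BirchSwinnertonDyer.Theorems.EtaConjADoorHecke

variable (p : ℕ) [hp : Fact p.Prime]

/-! ## §1 Door L6 with the Hecke-refined eigen-test, curve-generic and fact-free -/

/-- **(A) from the HECKE-refined eigen-test on `Cl(ℚ(P))` — NO named fact.** `W/ℚ` elliptic, `p` odd, `W[p]` irreducible, (c1)
`p ∤ #Gal(ℚ(W[p])/ℚ)`, a subfield `K ⊆ ℚ(W[p])` whose absolute Galois group fixes a non-zero `P ∈ W[p]` and fixes ONLY the multiples of
`P` (`hVH`), the Hecke-refined tautological eigen-test on `Cl(𝓞_K) ⊗ 𝔽_p` (every additive `μ : Cl(𝓞_K) → ZMod p` with (i)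
`μ([σ̄I]) = a • μ([I])` whenever `τ|_K = σ̄`, `τ • P = a • P`, and (iii) `μ(N_{L/K}((τ|_L) · i_{L/K}[I])) = (#Gal(L/K)·a) • μ([I])` whenever
`τ • P = a • P + Q` with `Q` in another eigenline, is zero — numerically: on the tautological line the Hecke operator `T_τ` does NOT act by
`Tr ρ̄(τ)`), `κ` cyclotomic, (c3) at `p` in the `E[p^∞]`-currency ⟹ statement (A). conjA-anchor g13's
`equivariantHom_classGroup_eq_zero_of_heckeEigenHom_subfield` at `S = ∅` + g17's `conjA_of_homTrivial_divisionField`.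
[cite: CoatesSujatha2005, §3 Thm. 3.4 and Lemma 3.8] [cite: DeoRaySujatha2023, §3 Thm. 3.8 (c2) and the definition of H′_L (arXiv:2202.09937 p. 9)]
[cite: NeukirchANT1999, Ch. III §1 Prop. (1.6) (iv)] -/
theorem conjA_of_heckeEigenHom_subfield
    (W : WeierstrassCurve ℚ) [W.IsElliptic] [NeZero p] (hp2 : p ≠ 2)
    [NumberField (W.divisionField p)]
    (hirr : W.HasIrreducibleModPGaloisRep p)
    (hG : ¬ p ∣ Nat.card ((W.divisionField p) ≃ₐ[ℚ] (W.divisionField p)))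
    (K : IntermediateField ℚ (W.divisionField p)) [NumberField K]
    (P : geomTorsion W (p : ℤ)) (hP0 : P ≠ 0)
    (hPK : ∀ τ : absoluteGaloisGroup ℚ,
      (∀ x : K, absRestrictNormalHom (W.divisionField p) τ (x : W.divisionField p) = x) → τ • P = P)
    (hVH : ∀ v : geomTorsion W (p : ℤ),
      (∀ τ : absoluteGaloisGroup ℚ,
        (∀ x : K, absRestrictNormalHom (W.divisionField p) τ (x : W.divisionField p) = x) → τ • v = v) →
      ∃ c : ℕ, v = c • P)
    (hEig : ∀ μ : Additive (ClassGroup (𝓞 K)) →+ ZMod p,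
      (∀ (τ : absoluteGaloisGroup ℚ) (σ : K ≃ₐ[ℚ] K) (a : ℕ),
          (∀ x : K, absRestrictNormalHom (W.divisionField p) τ (x : W.divisionField p) =
            ((σ x : K) : W.divisionField p)) → τ • P = a • P →
          ∀ (I J : (Ideal (𝓞 K))⁰),
            (J : Ideal (𝓞 K)) = (I : Ideal (𝓞 K)).map (AmbiguousClass.intAut σ : 𝓞 K →+* 𝓞 K) →
            μ (Additive.ofMul (ClassGroup.mk0 J)) = a • μ (Additive.ofMul (ClassGroup.mk0 I))) →
      (∀ (τ τ₁ : absoluteGaloisGroup ℚ) (a a₁ b : ℕ) (Q : geomTorsion W (p : ℤ)),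
          τ • P = a • P + Q → τ₁ • P = a₁ • P → τ₁ • Q = b • Q → (a₁ : ZMod p) ≠ (b : ZMod p) →
          ∀ I : (Ideal (𝓞 K))⁰,
            μ (Additive.ofMul (classGroupNorm K (W.divisionField p) (ClassGroup.mulEquiv
              (AmbiguousClass.intAut (absRestrictNormalHom (W.divisionField p) τ))
                (classGroupExtend K (W.divisionField p) (ClassGroup.mk0 I))))) =
              (Nat.card ((W.divisionField p) ≃ₐ[K] (W.divisionField p)) * a) •
                μ (Additive.ofMul (ClassGroup.mk0 I))) →
      μ = 0)
    {κ : ZpExtension ℚ p} (hκ : κ.IsCyclotomic)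
    (hc3 : ∀ v : HeightOneSpectrum (𝓞 ℚ), ((p : ℕ) : 𝓞 ℚ) ∈ v.asIdeal →
      ∀ x : W.geomPrimaryTorsion p, p • x = 0 → (∀ d ∈ decomp v, d • x = x) → x = 0) :
    ∃ (γ : absoluteGaloisGroup ℚ) (D : W.FineSelmerDualData κ γ),
      Module.Finite ℤ_[p] (RestrictScalars ℤ_[p] (IwasawaAlgebra p) D.X) := by
  -- `W[p]` is `p`-torsion and fixed by `Γ_{ℚ(W[p])}`
  have hpV : ∀ v : geomTorsion W (p : ℤ), p • v = 0 := by
    intro v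
    apply Subtype.ext
    have hv : ((v : geomTorsion W (p : ℤ)) : geomPoints W) ∈
        AddSubgroup.torsionBy (geomPoints W) (p : ℤ) := v.2
    rw [AddSubgroup.torsionBy, Submodule.mem_toAddSubgroup, Submodule.mem_torsionBy_iff] at hv
    rw [AddSubgroupClass.coe_nsmul, ZeroMemClass.coe_zero, ← natCast_zsmul]
    exact hv
  have hV : ∀ τ : absoluteGaloisGroup ℚ, absRestrictNormalHom (W.divisionField p) τ = 1 →
      ∀ v : geomTorsion W (p : ℤ), τ • v = v :=
    fun τ hτ v => (W.absRestrictNormalHom_divisionField_eq_one_iff p τ).mp hτ v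
  -- (c2*)₀ from the Hecke-refined eigen hypothesis with `S = ∅`
  have h0 : ∀ μ : Additive (ClassGroup (𝓞 (W.divisionField p))) →+ geomTorsion W (p : ℤ),
      (∀ (τ : absoluteGaloisGroup ℚ) (c : ClassGroup (𝓞 (W.divisionField p))),
        μ (Additive.ofMul (ClassGroup.mulEquiv
          (AmbiguousClass.intAut (absRestrictNormalHom (W.divisionField p) τ)) c)) =
          τ • μ (Additive.ofMul c)) → μ = 0 := by
    intro μ hμ
    refine equivariantHom_classGroup_eq_zero_of_heckeEigenHom_subfield (W.divisionField p) p hG hV hpV hirr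
      K P hP0 hPK hVH (∅ : Set ℕ) (fun ν h1 _ h3 => hEig ν h1 h3) μ
      ((EquivariantIwasawaLemma.equivariant_iff_forall_mk0
        (absRestrictNormalHom (W.divisionField p)) μ).mp hμ) ?_
    intro 𝔓 q hq _
    exact absurd hq (Set.notMem_empty q)
  exact conjA_of_homTrivial_divisionField W hp2 hG hκ h0
    (fun v hv x hx => geomTorsion_fixed_eq_zero_of_geomPrimaryTorsion W p v (hc3 v hv) x hx)

/-! ## §2 On the partner of a row of crux 19606 ((c1), (c3), irreducibility automatic) -/

section K8

open Summit.BirchSwinnertonDyer.BirchSwinnertonDyer.Theorems.EtaConjADoor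

variable (V : WeierstrassCurve ℚ) [V.IsElliptic] [V.IsGloballyMinimal] (W : WeierstrassCurve ℚ) [W.IsElliptic]
  (C : VariableChange ℚ)

/-- **(A) on the PARTNER `W` of a row of crux 19606 from the Hecke-refined eigen datum** (`C • W^{(p*)} = V`, `V` globally minimal, `p ≥ 5`
good, `a_p(V) = 0`, tower not onto): for one `P ∈ W[p] ∖ 0` with `K = ℚ(P)` (the stabiliser field): `hVH` (the `Γ_K`-fixed vectors of
`W[p]` are the multiples of `P`) and the Hecke-refined tautological eigen-test on `Cl(𝓞_K) ⊗ 𝔽_p` (kit: hecke13 verdict TWIST-TYPE or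
`T = 0` — the tautological class comes from `Sel₀(ℚ, V[p])` or a twist, not from `W`). (c1), (c3), irreducibility by p690512. No named fact.
[cite: CoatesSujatha2005, §3 Thm. 3.4 and Lemma 3.8] [cite: DeoRaySujatha2023, §3 Thm. 3.8 (c1)–(c3) (arXiv:2202.09937 p. 9)]
[cite: SilvermanAEC2009, X.5 Cor. 5.4] -/
theorem conjA_partner_of_heckeEigenHom [NeZero p] (hp5 : 5 ≤ p) (hC : C • W.quadraticTwist ((-1) ^ (p / 2) * p) = V)
    (hgood : V.HasGoodReductionAtPrime p) (hap : V.frobeniusTrace p = 0)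
    (hns : ¬ ∀ m : ℕ, V.HasSurjectiveModNGaloisRep (p ^ m : ℕ))
    (hP : haveI : NumberField (W.divisionField p) := NumberField.mk
      ∃ P : geomTorsion W (p : ℤ), P ≠ 0 ∧
        ∀ K : IntermediateField ℚ (W.divisionField p),
          K = IntermediateField.fixedField
            ((MulAction.stabilizer (absoluteGaloisGroup ℚ) P).map (absRestrictNormalHom (W.divisionField p))) →
        (∀ v : geomTorsion W (p : ℤ),
          (∀ τ : absoluteGaloisGroup ℚ,
            (∀ x : K, absRestrictNormalHom (W.divisionField p) τ (x : W.divisionField p) = x) → τ • v = v) →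
          ∃ c : ℕ, v = c • P) ∧
        ∀ μ : Additive (ClassGroup (𝓞 K)) →+ ZMod p,
          (∀ (τ : absoluteGaloisGroup ℚ) (σ : K ≃ₐ[ℚ] K) (a : ℕ),
              (∀ x : K, absRestrictNormalHom (W.divisionField p) τ (x : W.divisionField p) =
                ((σ x : K) : W.divisionField p)) → τ • P = a • P →
              ∀ (I J : (Ideal (𝓞 K))⁰),
                (J : Ideal (𝓞 K)) = (I : Ideal (𝓞 K)).map (AmbiguousClass.intAut σ : 𝓞 K →+* 𝓞 K) →
                μ (Additive.ofMul (ClassGroup.mk0 J)) = a • μ (Additive.ofMul (ClassGroup.mk0 I))) →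
          (∀ (τ τ₁ : absoluteGaloisGroup ℚ) (a a₁ b : ℕ) (Q : geomTorsion W (p : ℤ)),
              τ • P = a • P + Q → τ₁ • P = a₁ • P → τ₁ • Q = b • Q → (a₁ : ZMod p) ≠ (b : ZMod p) →
              ∀ I : (Ideal (𝓞 K))⁰,
                μ (Additive.ofMul (classGroupNorm K (W.divisionField p) (ClassGroup.mulEquiv
                  (AmbiguousClass.intAut (absRestrictNormalHom (W.divisionField p) τ))
                    (classGroupExtend K (W.divisionField p) (ClassGroup.mk0 I))))) =
                  (Nat.card ((W.divisionField p) ≃ₐ[K] (W.divisionField p)) * a) •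
                    μ (Additive.ofMul (ClassGroup.mk0 I))) →
          μ = 0)
    (κ : ZpExtension ℚ p) (hκ : κ.IsCyclotomic) :
    ∃ (γ : absoluteGaloisGroup ℚ) (D : W.FineSelmerDualData κ γ),
      Module.Finite ℤ_[p] (RestrictScalars ℤ_[p] (IwasawaAlgebra p) D.X) := by
  haveI : NumberField (W.divisionField p) := NumberField.mk
  obtain ⟨P, hP0, h⟩ := hP
  set K : IntermediateField ℚ (W.divisionField p) := IntermediateField.fixedField
    ((MulAction.stabilizer (absoluteGaloisGroup ℚ) P).map (absRestrictNormalHom (W.divisionField p))) with hKdef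
  obtain ⟨hVH, hEig⟩ := h K hKdef
  refine conjA_of_heckeEigenHom_subfield p W (by omega) (irreducible_partner V p W C hp5 hgood hap hC)
    (not_dvd_card_aut_divisionField_partner V p W C hp5 hgood hap hns hC) K P hP0 ?_ hVH hEig hκ
    (fun v hv x hpx hx => geomPrimaryTorsion_fixed_eq_zero_partner V p W C hp5 hgood hap hC v hv x hpx hx)
  -- `Γ_{ℚ(P)}` fixes `P` (as in p690512)
  intro τ' hτ'
  have hmem : absRestrictNormalHom (W.divisionField p) τ' ∈
      (MulAction.stabilizer (absoluteGaloisGroup ℚ) P).map (absRestrictNormalHom (W.divisionField p)) := by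
    rw [← IntermediateField.fixingSubgroup_fixedField
      ((MulAction.stabilizer (absoluteGaloisGroup ℚ) P).map (absRestrictNormalHom (W.divisionField p))),
      IntermediateField.mem_fixingSubgroup_iff]
    intro x hx
    exact hτ' ⟨x, hx⟩
  obtain ⟨τ₀, hτ₀, hres⟩ := Subgroup.mem_map.mp hmem
  have h1 : absRestrictNormalHom (W.divisionField p) (τ₀⁻¹ * τ') = 1 := by
    rw [map_mul, map_inv, hres, inv_mul_cancel]
  have h2 := (W.absRestrictNormalHom_divisionField_eq_one_iff p (τ₀⁻¹ * τ')).mp h1 P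
  rw [mul_smul, inv_smul_eq_iff] at h2
  rw [h2]; exact hτ₀

end K8

end Summit.BirchSwinnertonDyer.BirchSwinnertonDyer.Theorems.EtaConjADoorHecke

end
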